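import Summits.SmoothPoincare4.SmoothPoincare4.Theorems.ConvexBisectionAcyclicBisectionExistsBaseReflectionTwisting
import Literature.Topology.FourManifolds.HandleAttachingMapsTransport
import Literature.Topology.FourManifolds.HandleAttachingMapsAssoc
import HarnessLib

/-!
# Dual handles, SIGN-PIN: re-reading a page presentation of the complement piece through the
# fibred orientation-reversing involution of the cap
(sub-goal SIGN-PIN of stub `stub_T3_dualPresentation` (T3), line `modp-braid-orbits` r12, crux
`ConvexBisection.AcyclicBisectionExists`, item stmt-SmoothPoincare4-10508; wave 5, lead c5, worker X4;
registered sub-goal `helper_pagePresentation_baseReflection`)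

T3c-3 (`…DualLinkPageLink.lean`) presents the complement piece `W₂` over the cap `Base g` by
`2`-handles along framed PAGE curves with page twisting `if s then -1 else 1` for an undetermined
`s : Bool`; T3 clause (i) wants `-1`.  In the case `s = false` the presentation is RE-READ through
V3's fibred orientation-reversing involution `σ = baseReflection g` (`…BaseReflection*.lean`:
`w ∘ σ = w`, `rho ∘ σ = rho`, pages onto pages, `σ ∘ σ = id`, `det dσ = -1`, page twistings negated):

* §1 `exists_multiAttachmentData_transport` — the DATA form of the tree's
  `IsMultiAttachment.transport` (`HandleAttachingMapsTransport.lean`): if `P` is `M` with handles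
  attached along `h̄ᵢ` with data `D`, then along `G ∘ h̄ᵢ` (`HandleAttachingMap.transport`) with data
  `D'`, `D'.jA = D.jA ∘ G⁻¹` (`coresComplementCongr`) and `D'.jB = D.jB` — stated as an existence, no
  definition is introduced.
* §2 the three clauses of a positive allowable presentation under `σ`: pages are kept
  (`baseReflection_mem_page_iff`), homology shadows stay non-zero (`exists_shadow_baseReflection_comp`:
  `shadow (σ ∘ K) = S (shadow K)` for a linear automorphism `S` of `ℤ^{2g}`), and the page twisting of
  the transported handle framing `dσ(ν)` (`attachingFraming_transport`) is NEGATED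
  (`pageTwisting_baseReflection`, with `isSmoothEmbedding_attachingCircle`,
  `isKnotFraming_attachingFraming`).
* §3 the registered package `helper_pagePresentation_baseReflection`.

Everything is proved; no named facts, no `sorry`.

## References
* R. İ. Baykur, *Kähler decomposition of 4-manifolds*, AGT 6 (2006), proof of Thm. 5.1, p. 13 ("the
  NALF on `X₋` becomes a PALF on `−X₋`"). [Baykur2006]
* A. A. Kosinski, *Differential Manifolds* (1993), VI §6 and VIII, proof of (1.2). [Kosinski1993]
-/

noncomputable section

-- the prescribed namespace `Summit.<P>.<Sub>.…` duplicates `SmoothPoincare4` (P = Sub)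
set_option linter.dupNamespace false

open scoped Manifold ContDiff Topology

namespace Summit.SmoothPoincare4.SmoothPoincare4.Theorems.AcyclicBisectionExists.ModpBraidOrbits

open Set Function Metric
open Literature.Topology.FourManifolds Literature.Topology.FourManifolds.HandleAttachingMap
  Literature.Topology.FourManifolds.LefschetzBase Literature.Geometry.Symplectic

/-! ## §1 Transport of multi-attachment DATA along a diffeomorphism of the attaching manifold -/

section DataTransport

variable {n k : ℕ} {M : Type*} [TopologicalSpace M] [ChartedSpace (EuclideanHalfSpace (n + 1)) M]
  [IsManifold (𝓡∂ (n + 1)) ∞ M] [T2Space M]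
  {M' : Type*} [TopologicalSpace M'] [ChartedSpace (EuclideanHalfSpace (n + 1)) M']
  [IsManifold (𝓡∂ (n + 1)) ∞ M'] [T2Space M']
  {ι : Type*} [Finite ι] {h : ι → HandleAttachingMap n k M}
  {EP HP : Type*} [NormedAddCommGroup EP] [NormedSpace ℝ EP] [TopologicalSpace HP]
  {IP : ModelWithCorners ℝ EP HP} {P : Type*} [TopologicalSpace P] [ChartedSpace HP P]

/-- **Transport of multi-attachment data along a diffeomorphism of the attaching manifold** (the
data form of `IsMultiAttachment.transport`; Kosinski VI §6 with VIII, proof of (1.2)): if `P` is `M`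
with handles attached along `h̄ᵢ` with data `D` and `G : M ≅ M'`, then `P` is `M'` with handles
attached along the `G ∘ h̄ᵢ`, with data `D'` whose `M'`-piece embedding is `D.jA ∘ G⁻¹`
(`coresComplementCongr h G`) and whose handle embeddings are those of `D`.
[cite: Kosinski1993, VI §6 and VIII proof of (1.2)] -/
theorem exists_multiAttachmentData_transport (D : MultiAttachmentData h IP P)
    (G : M ≃ₘ⟮𝓡∂ (n + 1), 𝓡∂ (n + 1)⟯ M') :
    ∃ D' : MultiAttachmentData (fun i => (h i).transport G) IP P,
      (∀ a, D'.jA a = D.jA (coresComplementCongr h G a)) ∧ (∀ i b, D'.jB i b = D.jB i b) := by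
  set Ψ := coresComplementCongr h G with hΨ
  have hr : range (D.jA ∘ Ψ) = range D.jA := Ψ.surjective.range_comp D.jA
  refine ⟨{ disjoint := pairwise_disjoint_range_transport D.disjoint G
            jA := D.jA ∘ Ψ
            jB := D.jB
            hjA := D.hjA.comp_openPartialHomeomorph Ψ.toHomeomorph.toOpenPartialHomeomorph rfl
              (Ψ.contMDiff.contMDiffOn.congr fun x _ => rfl)
              (Ψ.symm.contMDiff.contMDiffOn.congr fun x _ => rfl)
            hjAo := by rw [hr]; exact D.hjAo
            hjB := D.hjB
            cover := by rw [hr]; exact D.cover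
            glue := fun i a' b => by
              rw [glueRel_transport_iff]
              exact D.glue i (Ψ a') b
            disjointB := D.disjointB }, fun a => rfl, fun i b => rfl⟩

end DataTransport

/-! ## §2 A positive allowable page presentation re-read through `σ` -/

section Reflect

variable {g : ℕ}

/-- Pages are kept: if the attaching circle of `q` lies in `page g c` then so does that of
`σ ∘ q` (`σ` maps every page onto itself). [folklore] -/
theorem transport_baseReflection_mem_page (q : HandleAttachingMap 3 2 (Base g)) {c : ℂ}
    (hq : ∀ θ, q.attachingCircle θ ∈ page g c) (θ : sphere (0 : EuclideanSpace ℝ (Fin 2)) 1) :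
    (q.transport (baseReflection g)).attachingCircle θ ∈ page g c := by
  rw [attachingCircle_transport_apply]
  exact (baseReflection_mem_page_iff _).2 (hq θ)

/-- The page clause of a family is kept by `σ`. [folklore] -/
theorem transport_baseReflection_pages {ι : Type*} (q : ι → HandleAttachingMap 3 2 (Base g))
    (hq : ∀ i, ∃ c : ℂ, ‖c‖ = 1 ∧ ∀ θ, (q i).attachingCircle θ ∈ page g c) (i : ι) :
    ∃ c : ℂ, ‖c‖ = 1 ∧ ∀ θ, ((q i).transport (baseReflection g)).attachingCircle θ ∈ page g c := by
  obtain ⟨c, hc, hK⟩ := hq i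
  exact ⟨c, hc, transport_baseReflection_mem_page (q i) hK⟩

/-- Non-zero homology shadows stay non-zero under `σ` (`shadow (σ ∘ K) = S (shadow K)` for a linear
automorphism `S` of `ℤ^{2g}`). [folklore] -/
theorem shadow_transport_baseReflection_ne_zero (q : HandleAttachingMap 3 2 (Base g))
    (hq : shadow g q.attachingCircle q.continuous_attachingCircle ≠ 0) :
    shadow g (q.transport (baseReflection g)).attachingCircle
      (q.transport (baseReflection g)).continuous_attachingCircle ≠ 0 := by
  obtain ⟨S, hS⟩ := exists_shadow_baseReflection_comp g
  have h1 : shadow g (q.transport (baseReflection g)).attachingCircle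
      (q.transport (baseReflection g)).continuous_attachingCircle =
      S (shadow g q.attachingCircle q.continuous_attachingCircle) :=
    hS q.attachingCircle q.continuous_attachingCircle
  rw [h1]
  exact fun h0 => hq (S.map_eq_zero_iff.1 h0)

/-- **The page twisting of the transported handle framing is negated**: for an attaching map `q`
whose attaching circle lies in a page, `σ ∘ q` has attaching circle `σ ∘ K` and handle framing
`dσ(ν)` (`attachingFraming_transport`), so `pageTwisting_baseReflection` applies. [folklore] -/
theorem pageTwisting_transport_baseReflection (q : HandleAttachingMap 3 2 (Base g)) {c : ℂ}
    (hc : ‖c‖ = 1) (hq : ∀ θ, q.attachingCircle θ ∈ page g c) :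
    pageTwisting g (q.transport (baseReflection g)).attachingCircle
        (q.transport (baseReflection g)).attachingFraming =
      -pageTwisting g q.attachingCircle q.attachingFraming := by
  have hfr : (q.transport (baseReflection g)).attachingFraming = fun θ =>
      mfderiv (𝓡∂ 4) (𝓡∂ 4) (baseReflection g) (q.attachingCircle θ) (q.attachingFraming θ) :=
    funext fun θ => attachingFraming_transport q (baseReflection g) θ
  rw [hfr, attachingCircle_transport]
  exact pageTwisting_baseReflection hc (isSmoothEmbedding_attachingCircle q) hq
    (isKnotFraming_attachingFraming q)

/-- The twisting clause of a family in pages with uniform twisting `ε` becomes `-ε`. [folklore] -/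
theorem transport_baseReflection_twisting {ι : Type*} (q : ι → HandleAttachingMap 3 2 (Base g))
    (hq : ∀ i, ∃ c : ℂ, ‖c‖ = 1 ∧ ∀ θ, (q i).attachingCircle θ ∈ page g c) {ε : ℤ}
    (htw : ∀ i, pageTwisting g (q i).attachingCircle (q i).attachingFraming = ε) (i : ι) :
    pageTwisting g ((q i).transport (baseReflection g)).attachingCircle
      ((q i).transport (baseReflection g)).attachingFraming = -ε := by
  obtain ⟨c, hc, hK⟩ := hq i
  rw [pageTwisting_transport_baseReflection (q i) hc hK, htw i]

end Reflect

/-! ## §3 The registered package -/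

/-- **Sub-goal `helper_pagePresentation_baseReflection` of stub `stub_T3_dualPresentation`** (T3 ▸
SIGN-PIN; wave 5, lead c5, worker X4): **a positive/negative allowable page presentation of `W₂` over
the cap, re-read through the fibred orientation-reversing involution `σ = baseReflection g`, is an
allowable page presentation with the OPPOSITE uniform page twisting.**  If `W₂` is `Base g` with
`2`-handles attached along `q i` (data `D`), every attaching circle in a page, every shadow non-zero
and every page twisting `= ε`, then `W₂` is `Base g` with `2`-handles attached along the
`σ`-transported maps `(q i).transport σ` with data `D'`, `D'.jA a = D.jA (σ a)` (`coresComplementCongr`;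
`σ⁻¹ = σ`), `D'.jB = D.jB`, attaching circles in the same pages, shadows non-zero, page twistings `-ε`
(Baykur: "the NALF on `X₋` becomes a PALF on `−X₋`"). [cite: Baykur2006, Thm. 5.1 (proof, p. 13)] -/
theorem helper_pagePresentation_baseReflection : ∀ (g : ℕ) (ι : Type) [Finite ι] (q : ι → Literature.Topology.FourManifolds.HandleAttachingMap 3 2 (Literature.Topology.FourManifolds.LefschetzBase.Base g)) (W₂ : Type) [TopologicalSpace W₂] [ChartedSpace (EuclideanHalfSpace 4) W₂] (D : Literature.Topology.FourManifolds.HandleAttachingMap.MultiAttachmentData q (𝓡∂ 4) W₂) (ε : ℤ), (∀ i, ∃ c : ℂ, ‖c‖ = 1 ∧ ∀ θ, (q i).attachingCircle θ ∈ Literature.Topology.FourManifolds.LefschetzBase.page g c) → (∀ i, Literature.Topology.FourManifolds.LefschetzBase.shadow g (q i).attachingCircle (q i).continuous_attachingCircle ≠ 0) → (∀ i, Literature.Topology.FourManifolds.LefschetzBase.pageTwisting g (q i).attachingCircle (q i).attachingFraming = ε) → ∃ D' : Literature.Topology.FourManifolds.HandleAttachingMap.MultiAttachmentData (fun i => (q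 i).transport (Summit.SmoothPoincare4.SmoothPoincare4.Theorems.AcyclicBisectionExists.ModpBraidOrbits.baseReflection g)) (𝓡∂ 4) W₂, (∀ a, D'.jA a = D.jA (Literature.Topology.FourManifolds.HandleAttachingMap.coresComplementCongr q (Summit.SmoothPoincare4.SmoothPoincare4.Theorems.AcyclicBisectionExists.ModpBraidOrbits.baseReflection g) a)) ∧ (∀ i b, D'.jB i b = D.jB i b) ∧ (∀ i, ∃ c : ℂ, ‖c‖ = 1 ∧ ∀ θ, ((q i).transport (Summit.SmoothPoincare4.SmoothPoincare4.Theorems.AcyclicBisectionExists.ModpBraidOrbits.baseReflection g)).attachingCircle θ ∈ Literature.Topology.FourManifolds.LefschetzBase.page g c) ∧ (∀ i, Literature.Topology.FourManifolds.LefschetzBase.shadow g ((q i).transport (Summit.SmoothPoincare4.SmoothPoincare4.Theorems.AcyclicBisectionExists.ModpBraidOrbits.baseReflection g)).attachingCircle ((q i).transport (Summit.SmoothPoincare4.SmoothPoincare4.Theorems.AcyclicBisectionExists.ModpBraidOrbits.baseReflection g)).continuous_attachingCircle ≠ 0) ∧ (∀ i, Literature.Topology.FourManifolds.LefschetzBase.pageTwisting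 g ((q i).transport (Summit.SmoothPoincare4.SmoothPoincare4.Theorems.AcyclicBisectionExists.ModpBraidOrbits.baseReflection g)).attachingCircle ((q i).transport (Summit.SmoothPoincare4.SmoothPoincare4.Theorems.AcyclicBisectionExists.ModpBraidOrbits.baseReflection g)).attachingFraming = -ε) := by
  intro g ι _ q W₂ _ _ D ε hpage hsh htw
  obtain ⟨D', hA, hB⟩ := exists_multiAttachmentData_transport D (baseReflection g)
  exact ⟨D', hA, hB, transport_baseReflection_pages q hpage,
    fun i => shadow_transport_baseReflection_ne_zero (q i) (hsh i),
    transport_baseReflection_twisting q hpage htw⟩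

end Summit.SmoothPoincare4.SmoothPoincare4.Theorems.AcyclicBisectionExists.ModpBraidOrbits

end
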